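import Mathlib.Data.Real.Basic
import Mathlib.LinearAlgebra.FiniteDimensional.Basic
import Mathlib.LinearAlgebra.Isomorphisms
import HarnessLib

/-!
# The fork at [IUTchIII] Corollary 3.12, XIII: LANA's basic prime-strips — "linked" is one hyperplane

Record-only file (D-0012) of the abc-iut cell's fork skeleton; TAKES NO SIDE. Project LANA's interim
report (Kato, Commelin, Hoshi, Kedlaya, Topaz; 16 Jul 2026; unrefereed; bib `LANA2026Report`) replaces
the `F^{⊩▶×μ}`-prime-strips between which [IUTchIII]'s Θ-link is an identification by a "nearly
equivalent substitute", the BASIC PRIME STRIP (BPS) = (étale-unit portion, value-group portion) (§4.1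
p. 23), and itself names the typing hazard (Rem. 8.2.1 p. 42): "the assertion that two BPSs are
"linked," in the sense that there exists an isomorphism between them, is a vacuous assertion since the
category of BPSs is a connected groupoid. Therefore, the concept of a "link" needs a more precise
definition that can be formalized in Lean." This file TYPES the value-group portion VERBATIM
(Def. 4.1.3, the map (4-3), the product formula `PF(B)`, Def. 4.1.4, Rem. 4.1.5, Def. 4.1.6) over an
arbitrary FINITE index set `V ⊇ V^bad` (modelling assumption: in print `V = 𝕍 = V(F_mod)` is the infinite
set of all valuations of `F_mod`, Notation 2.2.1 p. 12, and `V^bad_mod` "a non-empty finite subset",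
Def. 2.2.2 p. 12; the sums (4-3) are finitely supported and every statement below lives on the finite
bad-place sum, so finiteness of `V` is harmless — referee PASS-5 F1), takes the étale-unit portion as an INTERFACE (a type of objects
any two of which are isomorphic — Def. 4.1.2 (1) "an object abstractly isomorphic to
`{(G_v ↷ O^{×μ}_v, {I^κ_H}_H)}_{v∈V}`"; its honest construction needs local fields with Galois action,
abc-iut FOUNDATIONS rows 2–5 / LLANA-SPEC N3–N5), and PROVES:

* `ValueGroupBPS.iso_nonempty_iff` — LANA Lemma 4.1.7 (value-group part) `B ≅ B′ ⟺ PF(B) = PF(B′)`, by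
  their proof; `ValueGroupBPS.iso_subsingleton` — NOT printed, immediate: such an isomorphism is UNIQUE
  (pinned on the spanning local pilots), so `∃ iso` carries exactly the one bit "`PF(B) = PF(B′)`" — one
  hyperplane in `⊕_v ℝ_v` — and "the" isomorphism is no further datum;
* `PointedLine.iso_nonempty`/`iso_subsingleton` — in Rem. 4.1.5's normal form ANY two objects are
  isomorphic, uniquely: the groupoid is connected (Rem. 8.2.1) with singleton hom-sets;
* `BPS.iso_nonempty_iff` (Lemma 4.1.7 as printed, both portions), `BPS.linked_vacuous` (Rem. 8.2.1) and
  `BPS.isoEquivUnit`: granted `PF(B) = PF(B′)`, isomorphisms of full BPSs ↔ isomorphisms of the ÉTALE-UNIT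
  portions alone — all the freedom of a "link" sits in the unit portion, where LANA place (Ind1), (Ind2)
  (§6 p. 31, §6.2 (b) p. 33); the independence of the two components (Def. 4.1.6 (2)) is the feature of the
  Scholze–Stix rendering that [cite: Mochizuki2019Report, §10 pp. 15–16 (SSId2)] objects to, and LANA flag
  their own simplification in Rem. 7.1.1 p. 38 (the relevant link "is the `Θ^{×μ}_{LGP}`-link").

## What the source prints [cite: LANA2026Report, §4.1 pp. 23–24] (read on the page, nLab pdf)

Def. 4.1.3: "A value-group BPS is a pair `(C, {φ_v}_{v∈V})` (4-2) that consists of the data • a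
one-dimensional oriented `ℝ`-vector space `C`; • a collection of nonzero elements `{φ_v ∈ C}_{v∈V}`,
called the local pilots; such that `φ_C := Σ_{v∈V^bad} φ_v ∈ C` is nonzero. We shall refer to this sum
… as a pilot"; "(4-3) `⊕_{v∈V} ℝ_v → C`, where `ℝ_v` is a copy of `ℝ` for each `v ∈ V`, and the
`v`-component `ℝ_v → C` of this map is given by mapping `a ∈ ℝ_v` to `a·φ_v ∈ C`, is surjective. The
kernel of this map is said to be the product formula of `B`, denoted by `PF(B)`"; Def. 4.1.4: "An
isomorphism `Φ : B ⥲ B′` of value-group BPSs is an `ℝ`-linear isomorphism `C ⥲ C′` that maps `φ_v ∈ C`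
to `φ′_v ∈ C′` for every `v`"; Rem. 4.1.5: "The value-group BPSs that appear in the following discussion
all have the same product formula … In such a situation where the product formula is fixed, scaling the
local pilots `{φ_v}_{v∈V}` uniformly by a non-zero real number does not change the product formula;
therefore, a value-group BPS is simply given by • a one-dimensional oriented `ℝ`-vector space `C`; • a
negative element `φ_C ∈ C`, called the pilot. … a "pointed oriented real line""; Def. 4.1.6: "(1) A
basic prime strip (BPS) `B` is a pair `B = (B^{ét-unit}, B^{val})` … (2) An isomorphism of BPSs is a
pair consisting of an isomorphism of the étale-unit portions and an isomorphism of the value-group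
portions"; Lemma 4.1.7: "Two BPSs … are isomorphic to each other if and only if `PF(B) = PF(B′)`.
Proof. First, observe that we always have an isomorphism of the étale-unit portions. … Then it is
immediate that `Ker φ_C = Ker φ_{C′}`, i.e., `PF(B) = PF(B′)`. Conversely, if `PF(B) = PF(B′)`, then
there exists an `ℝ`-linear isomorphism `Φ : C → C′` which makes the above diagram commutative. □"

Modelling notes. (i) The ORIENTATION of `C` (Def. 4.1.3) is not carried as data: Def. 4.1.4's isomorphisms
are not asked to respect it and Lemma 4.1.7's proof does not use it (in Rem. 4.1.5's normal form it is the
requirement that the pilot be negative). (ii) Signs: Rem. 4.1.5 calls the pilot negative, §4.2 (c) p. 26 takes `φ_v = deg(q̲_v)`,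
`deg(a) = [F:ℚ]⁻¹ log #(O_{F_v}/a O_{F_v})`; only `φ_v ≠ 0` is used below. (iii) NOT here: the `q`-pilot/Θ-pilot
BPSs and the hexagon (sibling `ForkHexagon.lean`), the unit portion beyond the interface, any judgement.
-/

noncomputable section

open Module

namespace Summit.ABC
namespace IUTFork

/-! ## 1. Rem. 4.1.5's normal form: pointed real lines — connected, with singleton hom-sets -/

/-- LANA Rem. 4.1.5: with the product formula fixed "a value-group BPS is simply given by • a
one-dimensional oriented `ℝ`-vector space `C`; • a negative element `φ_C ∈ C`, called the pilot" — a
"pointed oriented real line". Typed: a one-dimensional real vector space with a distinguished NONZERO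
vector (orientation and sign: modelling notes (i), (ii) of the file header).
[cite: LANA2026Report, Rem. 4.1.5 p. 24] -/
structure PointedLine where
  /-- the line `C` -/
  C : Type
  [instAddCommGroup : AddCommGroup C]
  [instModule : Module ℝ C]
  /-- "one-dimensional" -/
  rank_one : finrank ℝ C = 1
  /-- the pilot `φ_C` -/
  pilot : C
  /-- "a negative element" — in particular nonzero -/
  pilot_ne : pilot ≠ 0

attribute [instance] PointedLine.instAddCommGroup PointedLine.instModule

namespace PointedLine

/-- An isomorphism of pointed lines ("morphisms of pointed vector spaces", §10.2 p. 47): an `ℝ`-linear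
isomorphism carrying the pilot to the pilot. [cite: LANA2026Report, Def. 4.1.4 p. 24, §10.2 p. 47] -/
structure Iso (L L' : PointedLine) where
  /-- the underlying linear isomorphism -/
  toEquiv : L.C ≃ₗ[ℝ] L'.C
  /-- pilot to pilot -/
  map_pilot : toEquiv L.pilot = L'.pilot

/-- Isomorphisms with the same underlying linear map are equal. [folklore] -/
theorem Iso.ext' {L L' : PointedLine} {Φ Ψ : Iso L L'} (h : Φ.toEquiv = Ψ.toEquiv) : Φ = Ψ := by
  cases Φ; cases Ψ; cases h; rfl
/-- In a line every vector is a multiple of the pilot. [folklore] -/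
theorem exists_smul_pilot (L : PointedLine) (x : L.C) : ∃ c : ℝ, c • L.pilot = x :=
  (finrank_eq_one_iff_of_nonzero' L.pilot L.pilot_ne).mp L.rank_one x

/-- **Rem. 8.2.1 in Rem. 4.1.5's normal form: the groupoid of pointed lines is CONNECTED** — any two are
isomorphic ("the category of BPSs is a connected groupoid", so "linked" "is a vacuous assertion").
[cite: LANA2026Report, Rem. 8.2.1 p. 42] -/
theorem iso_nonempty (L L' : PointedLine) : Nonempty (Iso L L') := by
  let b := FiniteDimensional.basisSingleton Unit L.rank_one L.pilot L.pilot_ne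
  let b' := FiniteDimensional.basisSingleton Unit L'.rank_one L'.pilot L'.pilot_ne
  refine ⟨⟨b.equiv b' (Equiv.refl Unit), ?_⟩⟩
  have h1 : b () = L.pilot := FiniteDimensional.basisSingleton_apply _ _ _ _ _
  have h2 : b' () = L'.pilot := FiniteDimensional.basisSingleton_apply _ _ _ _ _
  rw [← h1, Module.Basis.equiv_apply, Equiv.refl_apply, h2]

/-- … and MORE (not printed; immediate): between two pointed lines there is AT MOST ONE isomorphism (it
is pinned on the pilot, which spans) — hom-sets are singletons; "the isomorphism" is no datum either.
[folklore] -/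
theorem iso_subsingleton (L L' : PointedLine) : Subsingleton (Iso L L') := by
  refine ⟨fun Φ Ψ => Iso.ext' (LinearEquiv.ext fun x => ?_)⟩
  obtain ⟨c, rfl⟩ := L.exists_smul_pilot x
  rw [map_smul, map_smul, Φ.map_pilot, Ψ.map_pilot]

end PointedLine

/-! ## 2. Def. 4.1.3–4.1.4: value-group BPS with local pilots; the product formula; Lemma 4.1.7 -/

/-- LANA Def. 4.1.3: a VALUE-GROUP BPS over the finite index set `V` (the places) with bad subset
`V^bad = bad`: "a pair `(C, {φ_v}_{v∈V})` that consists of the data • a one-dimensional oriented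
`ℝ`-vector space `C`; • a collection of nonzero elements `{φ_v ∈ C}_{v∈V}`, called the local pilots;
such that `φ_C := Σ_{v∈V^bad} φ_v ∈ C` is nonzero" (orientation: modelling note (i)).
[cite: LANA2026Report, Def. 4.1.3 pp. 23–24] -/
structure ValueGroupBPS (V : Type) [Fintype V] (bad : Finset V) where
  /-- the line `C` -/
  C : Type
  [instAddCommGroup : AddCommGroup C]
  [instModule : Module ℝ C]
  /-- "one-dimensional" -/
  rank_one : finrank ℝ C = 1
  /-- the local pilots `φ_v ∈ C` -/
  φ : V → C
  /-- "nonzero elements" -/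
  φ_ne : ∀ v, φ v ≠ 0
  /-- the pilot `φ_C = Σ_{v ∈ V^bad} φ_v` "is nonzero" -/
  pilot_ne : ∑ v ∈ bad, φ v ≠ 0

attribute [instance] ValueGroupBPS.instAddCommGroup ValueGroupBPS.instModule

namespace ValueGroupBPS

variable {V : Type} [Fintype V] {bad : Finset V} (B B' : ValueGroupBPS V bad)

/-- The pilot `φ_C := Σ_{v∈V^bad} φ_v`. [cite: LANA2026Report, Def. 4.1.3 p. 24] -/
def pilot : B.C := ∑ v ∈ bad, B.φ v

/-- The map (4-3) `⊕_{v∈V} ℝ_v → C`, "mapping `a ∈ ℝ_v` to `a·φ_v ∈ C`": `a ↦ Σ_v a_v·φ_v`.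
[cite: LANA2026Report, §4.1 (4-3) p. 24] -/
def comb : (V → ℝ) →ₗ[ℝ] B.C := Fintype.linearCombination ℝ B.φ

/-- (4-3) evaluated. [folklore] -/
theorem comb_apply (a : V → ℝ) : B.comb a = ∑ v, a v • B.φ v :=
  Fintype.linearCombination_apply ℝ B.φ a

/-- (4-3) on the basis vector of `ℝ_v`: `1 ∈ ℝ_v ↦ φ_v`. [folklore] -/
theorem comb_single [DecidableEq V] (v : V) (r : ℝ) : B.comb (Pi.single v r) = r • B.φ v :=
  Fintype.linearCombination_apply_single ℝ B.φ v r

/-- "The kernel of this map is said to be the product formula of `B`, denoted by `PF(B)`" — a subspace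
of `⊕_{v∈V} ℝ_v`. [cite: LANA2026Report, §4.1 p. 24] -/
def PF : Submodule ℝ (V → ℝ) := LinearMap.ker B.comb

/-- Membership in the product formula: `a ∈ PF(B) ⟺ Σ_v a_v·φ_v = 0`. [folklore] -/
theorem mem_PF (a : V → ℝ) : a ∈ B.PF ↔ ∑ v, a v • B.φ v = 0 := by
  rw [PF, LinearMap.mem_ker, comb_apply]

/-- `V^bad ≠ ∅` (the pilot is a nonzero sum over it). [folklore] -/
theorem bad_nonempty (B : ValueGroupBPS V bad) : bad.Nonempty := Finset.nonempty_of_sum_ne_zero B.pilot_ne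

/-- "it is immediate that the `ℝ`-linear map [(4-3)] … is surjective" (`C` is a line and the local
pilots are nonzero). [cite: LANA2026Report, §4.1 p. 24] -/
theorem comb_surjective : Function.Surjective B.comb := by
  classical
  obtain ⟨v₀, -⟩ := B.bad_nonempty
  intro x
  obtain ⟨c, rfl⟩ := (finrank_eq_one_iff_of_nonzero' (B.φ v₀) (B.φ_ne v₀)).mp B.rank_one x
  exact ⟨Pi.single v₀ c, by rw [comb_single]⟩

/-- LANA Def. 4.1.4: "An isomorphism `Φ : B ⥲ B′` of value-group BPSs is an `ℝ`-linear isomorphism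
`C ⥲ C′` that maps `φ_v ∈ C` to `φ′_v ∈ C′` for every `v`." [cite: LANA2026Report, Def. 4.1.4 p. 24] -/
structure Iso (B B' : ValueGroupBPS V bad) where
  /-- the underlying linear isomorphism `C ⥲ C′` -/
  toEquiv : B.C ≃ₗ[ℝ] B'.C
  /-- local pilots to local pilots -/
  map_φ : ∀ v, toEquiv (B.φ v) = B'.φ v

variable {B B'}

/-- Isomorphisms with the same underlying linear map are equal. [folklore] -/
theorem Iso.ext' {Φ Ψ : Iso B B'} (h : Φ.toEquiv = Ψ.toEquiv) : Φ = Ψ := by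
  cases Φ; cases Ψ; cases h; rfl

/-- The square of Lemma 4.1.7's proof commutes: `Φ(Σ a_v·φ_v) = Σ a_v·φ′_v`.
[cite: LANA2026Report, Lemma 4.1.7 p. 24] -/
theorem Iso.apply_comb (Φ : Iso B B') (a : V → ℝ) : Φ.toEquiv (B.comb a) = B'.comb a := by
  simp only [comb_apply, map_sum, map_smul, Φ.map_φ]

/-- An isomorphism carries the pilot to the pilot. [folklore] -/
theorem Iso.map_pilot (Φ : Iso B B') : Φ.toEquiv B.pilot = B'.pilot := by
  simp only [pilot, map_sum, Φ.map_φ]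

/-- **Lemma 4.1.7, "only if"**: "it is immediate that `Ker φ_C = Ker φ_{C′}`, i.e., `PF(B) = PF(B′)`."
[cite: LANA2026Report, Lemma 4.1.7 p. 24] -/
theorem PF_eq_of_iso (Φ : Iso B B') : B.PF = B'.PF := by
  ext a
  simp only [PF, LinearMap.mem_ker]
  rw [← Φ.apply_comb, LinearEquiv.map_eq_zero_iff]

variable (B B')

/-- The canonical isomorphism `(⊕_v ℝ_v)/PF(B) ⥲ C` induced by the surjection (4-3).
[cite: LANA2026Report, Lemma 4.1.7 p. 24] -/
def quotEquiv : ((V → ℝ) ⧸ B.PF) ≃ₗ[ℝ] B.C :=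
  B.comb.quotKerEquivOfSurjective B.comb_surjective

/-- `quotEquiv [a] = Σ a_v·φ_v`. [folklore] -/
theorem quotEquiv_mk (a : V → ℝ) : B.quotEquiv (Submodule.Quotient.mk a) = B.comb a :=
  LinearMap.quotKerEquivOfSurjective_apply_mk B.comb B.comb_surjective a

variable {B B'}

/-- **Lemma 4.1.7, "if"**: "Conversely, if `PF(B) = PF(B′)`, then there exists an `ℝ`-linear isomorphism
`Φ : C → C′` which makes the above diagram commutative" — namely `C ≅ (⊕ℝ_v)/PF(B) = (⊕ℝ_v)/PF(B′) ≅ C′`.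
[cite: LANA2026Report, Lemma 4.1.7 p. 24] -/
def isoOfPFEq (h : B.PF = B'.PF) : Iso B B' where
  toEquiv := (B.quotEquiv.symm.trans (Submodule.quotEquivOfEq _ _ h)).trans B'.quotEquiv
  map_φ v := by
    classical
    have hv : B.φ v = B.comb (Pi.single v 1) := by rw [comb_single, one_smul]
    have hv' : B'.φ v = B'.comb (Pi.single v 1) := by rw [comb_single, one_smul]
    rw [hv, LinearEquiv.trans_apply, LinearEquiv.trans_apply]
    rw [show B.quotEquiv.symm (B.comb (Pi.single v 1)) = Submodule.Quotient.mk (Pi.single v 1) from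
      LinearMap.quotKerEquivOfSurjective_symm_apply B.comb B.comb_surjective _]
    rw [Submodule.quotEquivOfEq_mk, quotEquiv_mk, ← hv']

/-- Identity isomorphism (the groupoid structure of Def. 4.1.4: identities). [folklore] -/
def Iso.refl (B : ValueGroupBPS V bad) : Iso B B := ⟨LinearEquiv.refl ℝ B.C, fun _ => rfl⟩

/-- Inverse isomorphism (the groupoid structure of Def. 4.1.4: inverses). [folklore] -/
def Iso.symm (Φ : Iso B B') : Iso B' B :=
  ⟨Φ.toEquiv.symm, fun v => by rw [LinearEquiv.symm_apply_eq, Φ.map_φ]⟩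

/-- Composite isomorphism (the groupoid structure of Def. 4.1.4: composition). [folklore] -/
def Iso.trans {B'' : ValueGroupBPS V bad} (Φ : Iso B B') (Ψ : Iso B' B'') : Iso B B'' :=
  ⟨Φ.toEquiv.trans Ψ.toEquiv, fun v => by rw [LinearEquiv.trans_apply, Φ.map_φ, Ψ.map_φ]⟩

variable (B B')

/-- Every self-isomorphism is the identity (e.g. the `q`-side of the Scholze–Stix hexagon "scales by a
factor of `1`", §10.2 p. 47). [folklore] -/
theorem iso_self_eq_refl (Φ : Iso B B) : Φ.toEquiv = LinearEquiv.refl ℝ B.C := by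
  refine LinearEquiv.ext fun x => ?_
  obtain ⟨a, rfl⟩ := B.comb_surjective x
  rw [Φ.apply_comb, LinearEquiv.refl_apply]

/-- **LANA Lemma 4.1.7 (value-group portions).** `B ≅ B′ ⟺ PF(B) = PF(B′)`.
[cite: LANA2026Report, Lemma 4.1.7 p. 24] -/
theorem iso_nonempty_iff : Nonempty (Iso B B') ↔ B.PF = B'.PF :=
  ⟨fun ⟨Φ⟩ => PF_eq_of_iso Φ, fun h => ⟨isoOfPFEq h⟩⟩

/-- **Uniqueness (not printed; immediate).** Two isomorphisms `B ⥲ B′` of value-group BPSs coincide: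
the local pilots span `C` ((4-3) is surjective) and an isomorphism is pinned on them. Consequently the
"full poly-isomorphism" between two value-group BPSs with the same product formula consists of ONE
isomorphism, and `∃ Φ : B ≅ B′` carries exactly the one bit `PF(B) = PF(B′)`. [folklore] -/
theorem iso_subsingleton : Subsingleton (Iso B B') := by
  refine ⟨fun Φ Ψ => Iso.ext' (LinearEquiv.ext fun x => ?_)⟩
  obtain ⟨a, rfl⟩ := B.comb_surjective x
  rw [Φ.apply_comb, Ψ.apply_comb]

/-! ### Rem. 4.1.5: forgetting the local pilots -/

/-- The pointed line `(C, φ_C)` underlying a value-group BPS (Rem. 4.1.5's normal form).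
[cite: LANA2026Report, Rem. 4.1.5 p. 24] -/
def toPointedLine : PointedLine where
  C := B.C
  rank_one := B.rank_one
  pilot := B.pilot
  pilot_ne := B.pilot_ne

/-- An isomorphism of value-group BPSs IS (in particular) the isomorphism of their pointed lines.
[cite: LANA2026Report, Rem. 4.1.5 p. 24] -/
def Iso.toPointed {B B' : ValueGroupBPS V bad} (Φ : Iso B B') :
    PointedLine.Iso B.toPointedLine B'.toPointedLine := ⟨Φ.toEquiv, Φ.map_pilot⟩

/-- **What Rem. 4.1.5's simplification forgets.** The pointed lines of ANY two value-group BPSs are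
isomorphic (uniquely: `PointedLine.iso_subsingleton`) — also when `PF(B) ≠ PF(B′)`, in which case the BPSs
themselves are NOT isomorphic (Lemma 4.1.7). "scaling the local pilots `{φ_v}_{v∈V}` uniformly by a
non-zero real number does not change the product formula; therefore, a value-group BPS is simply given by …
a "pointed oriented real line."": legitimate exactly under the standing assumption "all have the same
product formula", and that assumption is then the entire content of "linked" (Rem. 8.2.1).
[cite: LANA2026Report, Rem. 4.1.5 p. 24] -/
theorem pointed_iso_always : Nonempty (PointedLine.Iso B.toPointedLine B'.toPointedLine) :=
  PointedLine.iso_nonempty _ _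

/-- Witness that the product formula is genuine information: over two (bad) places with `C = ℝ`, local
pilots `(1, 1)` versus `(1, 2)` have different product formulas (`(1, −1)` lies in the first kernel only),
hence the BPSs are NOT isomorphic — while their pointed lines are. [folklore] -/
theorem exists_not_iso :
    ∃ B B' : ValueGroupBPS (Fin 2) Finset.univ, IsEmpty (Iso B B') ∧
      Nonempty (PointedLine.Iso B.toPointedLine B'.toPointedLine) := by
  let B : ValueGroupBPS (Fin 2) Finset.univ :=
    { C := ℝ, rank_one := Module.finrank_self ℝ, φ := fun _ => 1, φ_ne := fun _ => one_ne_zero,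
      pilot_ne := by norm_num }
  let B' : ValueGroupBPS (Fin 2) Finset.univ :=
    { C := ℝ, rank_one := Module.finrank_self ℝ, φ := fun v => (v : ℝ) + 1,
      φ_ne := fun v => by positivity, pilot_ne := by rw [Fin.sum_univ_two]; norm_num }
  refine ⟨B, B', ⟨fun Φ => ?_⟩, pointed_iso_always B B'⟩
  have hPF := PF_eq_of_iso Φ
  have ha : (![1, -1] : Fin 2 → ℝ) ∈ B.PF := by rw [mem_PF, Fin.sum_univ_two]; norm_num [B]
  rw [hPF, mem_PF, Fin.sum_univ_two] at ha
  norm_num [B'] at ha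

end ValueGroupBPS

/-! ## 3. Def. 4.1.6: the full BPS, with the étale-unit portion as an interface -/

/-- INTERFACE for LANA Def. 4.1.1/4.1.2 (étale and étale-unit BPS): a type of objects with, between any
two, a type of isomorphisms that is INHABITED — Def. 4.1.2 (1): an étale-unit BPS "is an object
abstractly isomorphic to `{(G_v ↷ O^{×μ}_v, {I^κ_H}_H)}_{v∈V}`", whence Lemma 4.1.7's proof: "we always
have an isomorphism of the étale-unit portions". Nothing else about the unit portion is assumed (its
construction — local Galois groups acting on `O^{×μ}` with the `×μ`-Kummer structure, Def. 3.9.1 p. 22 —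
is campaign work, LLANA-SPEC N3–N5); in particular `Iso a b` may be large (automorphisms: the source of
(Ind1), (Ind2), §6 p. 31). [cite: LANA2026Report, Def. 4.1.2 p. 23] -/
structure UnitPortion where
  /-- the étale-unit BPSs -/
  Obj : Type
  /-- isomorphisms of étale-unit BPSs (Def. 4.1.2 (2)) -/
  Iso : Obj → Obj → Type
  /-- any two are isomorphic ("abstractly isomorphic to" the standard one) -/
  conn : ∀ a b, Nonempty (Iso a b)

/-- LANA Def. 4.1.6 (1): "A basic prime strip (BPS) `B` is a pair `B = (B^{ét-unit}, B^{val})` of an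
étale-unit BPS and a value-group BPS." [cite: LANA2026Report, Def. 4.1.6 p. 24] -/
structure BPS (𝓤 : UnitPortion) (V : Type) [Fintype V] (bad : Finset V) where
  /-- the étale-unit portion -/
  unit : 𝓤.Obj
  /-- the value-group portion -/
  val : ValueGroupBPS V bad

namespace BPS

variable {𝓤 : UnitPortion} {V : Type} [Fintype V] {bad : Finset V} (B B' : BPS 𝓤 V bad)

/-- LANA Def. 4.1.6 (2): "An isomorphism of BPSs is a pair consisting of an isomorphism of the
étale-unit portions and an isomorphism of the value-group portions." [cite: LANA2026Report, Def. 4.1.6 p. 24] -/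
def Iso : Type := 𝓤.Iso B.unit B'.unit × ValueGroupBPS.Iso B.val B'.val

/-- **LANA Lemma 4.1.7 (as printed, both portions).** "Two BPSs … are isomorphic to each other if and
only if `PF(B) = PF(B′)`." [cite: LANA2026Report, Lemma 4.1.7 p. 24] -/
theorem iso_nonempty_iff : Nonempty (B.Iso B') ↔ B.val.PF = B'.val.PF := by
  constructor
  · rintro ⟨⟨-, Φ⟩⟩
    exact ValueGroupBPS.PF_eq_of_iso Φ
  · intro h
    obtain ⟨u⟩ := 𝓤.conn B.unit B'.unit
    exact ⟨(u, ValueGroupBPS.isoOfPFEq h)⟩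

/-- **Rem. 8.2.1, typed.** Under the standing assumption of Rem. 4.1.5 (all product formulas equal) any
two BPSs are isomorphic: "the category of BPSs is a connected groupoid", so "the assertion that two BPSs
are "linked," in the sense that there exists an isomorphism between them, is a vacuous assertion".
[cite: LANA2026Report, Rem. 8.2.1 p. 42] -/
theorem linked_vacuous (h : B.val.PF = B'.val.PF) : Nonempty (B.Iso B') :=
  (iso_nonempty_iff B B').mpr h

/-- **Where the freedom of a link sits.** Granted `PF(B) = PF(B′)`, isomorphisms of BPSs `B ⥲ B′`
correspond bijectively to isomorphisms of the ÉTALE-UNIT portions (the value-group component is forced: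
`ValueGroupBPS.iso_subsingleton`). So in LANA's typed object the "full poly-isomorphism" of the Θ-link
(§7.1 (b) p. 38) is, beyond one hyperplane, a set of unit-portion isomorphisms — the place of "(Ind1) …
the indeterminacy arising from `Aut(G_v)`. (Ind2) … the automorphism group of `O^×_v` as a monoid with
`G_v`-action" (§6 p. 31; §6.2 (b) p. 33 "Since this choice is not canonical, Ind1 and Ind2 arise"); and the
independence of the two components in Def. 4.1.6 (2) is what [cite: Mochizuki2019Report, §10 pp. 15–16 (SSId2)]
objects to in the Scholze–Stix rendering ("treated … as independent, unrelated objects").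
[cite: LANA2026Report, §6 p. 31 (Ind1), (Ind2)] -/
def isoEquivUnit (h : B.val.PF = B'.val.PF) : B.Iso B' ≃ 𝓤.Iso B.unit B'.unit where
  toFun p := p.1
  invFun u := (u, ValueGroupBPS.isoOfPFEq h)
  left_inv _ := Prod.ext rfl ((ValueGroupBPS.iso_subsingleton B.val B'.val).elim _ _)
  right_inv _ := rfl

end BPS
end IUTFork
end Summit.ABC
end
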